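import Literature.NumberTheory.Automorphic.Liu2021.SplitPlaceOscillatorModel
import Literature.NumberTheory.Automorphic.Liu2021.Def411IrreducibleOfLemD1AsPrinted
import Literature.NumberTheory.Automorphic.ParabolicInduction
import Literature.NumberTheory.Automorphic.AdicCompletionLocalField
import Literature.NumberTheory.Automorphic.AdelicSecondCountable
import Literature.NumberTheory.Automorphic.QuadraticLocalBaseChange
import Literature.NumberTheory.Automorphic.UnitaryGroupNonsplitPlace
import Literature.RepresentationTheory.IrreducibleTwistTransport
import Literature.RepresentationTheory.TwistedCoinvariantsCentralCharacterQuotient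
import HarnessLib

/-!
# Line `b4-split-place-model` — [Liu2021, proof of Lem. D.1, first paragraph (the case `E = F × F`)] AT A SPLIT PLACE:
# irreducible ∧ admissible ∧ non-zero `χ_v`-quotient of the honest local Weil representation, `n ≥ 3`
# (fan B, rung B-IV; cell hodgecm-mathlib; SUB-SKELETON of line `b4-lemD1-item1-at-v`, stub (3))

SKELETON (crux workfile draft).  TARGET = LITERALLY the statement of `HodgecmMathlib.B4.LemD1Item1AtV.stub_splitPlace_model_consequences`
(line `b4-lemD1-item1-at-v` v5, B-plan/lines/b4-lemD1-item1-at-v.lean): in the §LocalData telescope of `localLemD1Data … v`, for a Haar measure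
`μ'` on `F_v`,  `¬ IsField (LocalRing E v) → (𝓢.omegaLoc v).IsL2Isometric (μ'ⁿ) → IsIrreducibleOrZero Θ ∧ Θ.IsAdmissible ∧ Nontrivial (Coinv …)`
where `Θ = TwistedCoinv.rep χ_{1,v} (𝓢.omegaLoc v) _` is the maximal `χ_{1,v}`-quotient of `ω_v` along the local centre `U(⟨a⟩)(F_v) → U(V)(F_v)`.
The composition `splitPlace_model_consequences_of` below has exactly that conclusion, so `stub_splitPlace_model_consequences := splitPlace_model_consequences_of
… stub_IV3a stub_IV3b stub_IV3c stub_leviChar μ'` closes stub (3) of the parent line (one line, to be done by the parent's lead once the four stubs close).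

WHY THIS LINE: at a split place `v` (`E_v = E_w × E_{cw} ≅ F_v × F_v`) the pair (centre, `U(V)(F_v)`) is the type-2 pair `(GL_1, GL_n)` and the print
([Liu2021, App. D, proof of Lem. D.1, p. 126]; [GelbartRogawski1990, §2.6]; held proof [MoeglinVignerasWaldspurger1987, Chap. 3 §III.1 + §III.7 a)])
IDENTIFIES the `χ`-quotient with ONE explicit representation, the unitary parabolic induction `Ind_{Q_{n-1,1}}^{GL_n}((ν∘det) ⊠ χ′ν^{1-n})`; the three
clauses then come from three independent, citable properties of parabolic induction on `GL_n` over a non-archimedean local field: IRREDUCIBLE for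
unitary inducing characters [Zelevinsky1980, Thm. 4.2] (tree fact `parabolicIndGL_detChar_unitary_isIrreducible`, B-typ01 p589979), ADMISSIBLE
[BernsteinZelevinsky1977, Prop. 2.3] (tree fact `Representation.isAdmissible_parabolicIndGL`), NON-ZERO because irreducible representations live on
non-zero spaces (Mathlib: `IsSimpleOrder` is `Nontrivial`).  STRATEGY tag: `explicit-model + BZ-induction` (as opposed to `minguez-type2` = Howe
duality for the type-2 pair `(GL_1, GL_n)` [Minguez2008], which would give irreducible-or-zero but NOT the non-vanishing, and to a `mixed-model`
line computing the `χ`-coinvariants of `𝒮(F_vⁿ)` under the centre by hand [MVW87, III.2 Lemme] — not drafted).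
The transport from the model to `Θ` (along `AreIsomorphicRep` and the split-place isomorphism `UnitaryGroup.localPiSplitEquiv : U(V)(F_v) ≃ₜ* GL_n(E_w)`)
is PROVED here (`transport_of_areIsomorphicRep_comp_symm`), as is the choice of the split place `w ∣ v` with `c • w ≠ w` from `¬ IsField (LocalRing E v)`
(`PlacesOver.nonempty`, `LocalRing.isField_of_smul_eq`) and the unitarity ∕ continuity bookkeeping for `χ′ν^{1-n}`.

STUBS (registered open lemmas, sorried; sizes in the card `b4-split-place-model.md`):
* `stub_splitPlace_chiCoinv_iso_parabolicIndGL : Liu2021.splitPlace_chiCoinv_iso_parabolicIndGL` (XL) — THE MODEL, B-typ01's named fact IV-3(a)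
  (p590532, `Liu2021/SplitPlaceOscillatorModel.lean`): MVW Chap. 3 §III.1 (the type-2 Schrödinger model `σ(gg′)f(x) = f(ᵗgxg′)` twisted by
  `ν_m^{m′/2} ⊗ ν_{m′}^{m/2}`) + §III.7 a) (`m = 1`: the largest `χ`-quotient of `𝒮(F^{m′})` is the unique irreducible quotient of `ind(P_{m′-1}, 1 ⊗ χ)`)
  + unitarity of `ω_s` to pin the twist.  Tree has: `localSchrodinger`, `LocalMp`, `MpPsi.toRep`, `localPiSplitEquiv`, `parabolicIndGL`, `SmoothInd`,
  `TwistedCoinv`; lacks: the mixed ∕ type-2 model of `ω_v|_{GL_n}` at a split place (an explicit intertwiner `𝒮(F_vⁿ) → Ind`), Frobenius reciprocity for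
  `SmoothInd` in the needed direction, the Jacquet module of `𝒮(F_vⁿ)` along `Q_{n-1,1}`.
* `stub_parabolicIndGL_detChar_unitary_isIrreducible : Zelevinsky1980.parabolicIndGL_detChar_unitary_isIrreducible` (L) — B-typ01's fact IV-3(b)
  (p589979): `Ind((ν∘det) ⊠ χ′)` irreducible for UNITARY `ν, χ′` [Zelevinsky1980, Thm. 4.2 (segments not linked ⇒ irreducible); here the two
  segments are a character of `GL_{n-1}` and a character of `GL_1`, linked iff `χ′ν^{-1} = |·|^{±n/2}`, impossible for unitary data].  Tree has:
  `parabolicIndGL`, `jacquetGL`, `normalizedJacquetGL`, `isFiniteLength_parabolicIndGL` (fact), Bernstein–Zelevinsky geometric lemma NOT in tree;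
  lacks: Zelevinsky's segment classification ∕ the irreducibility criterion (any proof: BZ geometric lemma + exponents, or Mackey theory for the
  mirabolic).
* `stub_isAdmissible_parabolicIndGL (w) : Representation.isAdmissible_parabolicIndGL (E_w) (lastBlockLabel n)` (L) — the tree's named fact
  (`Automorphic/ParabolicGL.lean`), [BernsteinZelevinsky1977, Prop. 2.3]: `P \ GL_n` compact (Iwasawa `GL_n = P·GL_n(𝒪)`) + smooth vectors.  Tree has:
  `SmoothInd`, `smoothIndRep`, `instLocallyCompactSpaceStandardParabolicGL`, `Representation.IsAdmissible`; lacks: the Iwasawa decomposition for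
  `GL_n(E_w)` relative to `Q_{n-1,1}` and the finiteness of `P\G/K`.
* `stub_isAdmissible_leviChar (w ν χ′ …)` (M) — the inducing ONE-DIMENSIONAL representation `(trivial).twist (maxParabolicLeviChar (E_w) n ν (χ′ν^{1-n}))`
  of the Levi `GL_{n-1}(E_w) × GL_1(E_w)` is admissible: a CONTINUOUS character of a totally disconnected locally compact group into `ℂˣ` is trivial
  on an open subgroup (`ℂˣ` has no small subgroups), so the representation is smooth, and fixed vectors of a 1-dimensional space are finite-dimensional.
  Mathlib has: `TotallyDisconnectedSpace`, `IsTopologicalGroup.exists_openSubgroup…`-type lemmas for profinite groups, `Module.Finite` of `ℂ`;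
  tree has `Representation.IsSmooth ∕ IsAdmissible`, `maxParabolicLeviChar`; lacks: «continuous `ℂˣ`-valued character of a t.d. group is locally
  constant» (no-small-subgroups argument) as a lemma.
COMPOSITION (kernel-checked): `splitPlace_model_consequences_of`.  HC_CM is proved only modulo the 7 printed citations until rung 0 closes; nothing
here changes that.
-/

set_option autoImplicit false

noncomputable section

open scoped Matrix Kronecker TensorProduct Classical RestrictedProduct
open NumberField NumberField.mixedEmbedding IsDedekindDomain Filter Set
open Literature.NumberTheory.Automorphic Literature.NumberTheory.Automorphic.UnitaryGroup
open Literature.NumberTheory.Weil1964 Literature.RepresentationTheory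
open Literature.RepresentationTheory.HeisenbergGroup
open Literature.GroupTheory.RestrictedProductCharacter
open Literature.NumberTheory Literature.NumberTheory.GelbartRogawski1991 Literature.NumberTheory.GelbartRogawski1991.UnitaryDualPair
open Literature.NumberTheory.GelbartRogawski1991.UnitaryDualPair.WeilCoinv
open Literature.NumberTheory.Automorphic.Liu2021 Literature.NumberTheory.Automorphic.Liu2021.Def411WeilCarriers
open Literature.NumberTheory.Automorphic.Zelevinsky1980
open MeasureTheory

/-! ## §T Transport along `AreIsomorphicRep` and a topological group isomorphism (PROVED) -/

namespace HodgecmMathlib.B4.SplitPlaceModel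

/-- **Transport (PROVED).** If `T ∘ e⁻¹ ≅ ρ₂` (`AreIsomorphicRep`, an intertwining linear equivalence) for a topological group isomorphism
`e : G ≃ₜ* G'`, and `ρ₂` is irreducible and admissible, then `T` is irreducible, admissible, and lives on a non-zero space.
(`Representation.isIrreducible_iff_of_equivariant`, `Representation.IsAdmissible.of_equivariant_mulEquiv`, and `IsSimpleOrder ⇒ Nontrivial`.)
[cite: BernsteinZelevinsky1976, Definition 2.1(b)] -/
theorem transport_of_areIsomorphicRep_comp_symm {G G' : Type*} [Group G] [Group G'] [TopologicalSpace G] [TopologicalSpace G']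
    {V V' : Type*} [AddCommGroup V] [Module ℂ V] [AddCommGroup V'] [Module ℂ V']
    (T : Representation ℂ G V) (ρ₂ : Representation ℂ G' V') (e : G ≃ₜ* G')
    (h : AreIsomorphicRep (T.comp e.symm.toMonoidHom) ρ₂) (hirr : ρ₂.IsIrreducible) (hadm : ρ₂.IsAdmissible) :
    T.IsIrreducible ∧ T.IsAdmissible ∧ Nontrivial V := by
  obtain ⟨f, hf⟩ := h
  have he : ∀ (g : G) (x : V), f (T g x) = ρ₂ (e g) (f x) := fun g x => by
    have h1 := hf (e g) x
    have h2 : (T.comp e.symm.toMonoidHom) (e g) = T g := by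
      change T (e.symm (e g)) = T g
      rw [ContinuousMulEquiv.symm_apply_apply]
    rw [h2] at h1
    exact h1
  have h1 : T.IsIrreducible :=
    (Representation.isIrreducible_iff_of_equivariant T ρ₂ e.toMonoidHom e.surjective f he).2 hirr
  have h2 : T.IsAdmissible :=
    Representation.IsAdmissible.of_equivariant_mulEquiv (ρ := ρ₂) T e.symm f.symm (fun g' y => by
      apply f.injective
      rw [f.apply_symm_apply, he, ContinuousMulEquiv.apply_symm_apply, f.apply_symm_apply]) hadm
  have h3 : Nontrivial V := by
    by_contra hV
    rw [not_nontrivial_iff_subsingleton] at hV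
    have : (⊥ : Subrepresentation T) = ⊤ := Subrepresentation.toSubmodule_injective (Subsingleton.elim _ _)
    exact (h1.bot_ne_top) this
  exact ⟨h1, h2, h3⟩

/-! ## §S The stubs -/

/-- **stub (XL) = B-typ01's named fact IV-3(a) `Liu2021.splitPlace_chiCoinv_iso_parabolicIndGL`** — THE SPLIT-PLACE MODEL [Liu2021, App. D, proof of
Lem. D.1, first paragraph, p. 126; GelbartRogawski1990 §2.6; proved in MoeglinVignerasWaldspurger1987, Chap. 3 §III.1 + §III.7 a)]: at a split place,
for every smooth UNITARY section `s` over `iota` and every unitary continuous `χ` of the centre, `∃ ν χ′` unitary continuous characters of `E_wˣ` with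
`(TwistedCoinv.rep χ ω_s _) ∘ localPiSplitEquiv⁻¹ ≅ parabolicIndGL (E_w) (lastBlockLabel N) ((trivial).twist (maxParabolicLeviChar (E_w) N ν (χ′ν^{1-N})))`.
Closed by `theorem splitPlace_chiCoinv_iso_parabolicIndGL_holds` (KEY candidate `b4-split-place-model`).  Tree has ∕ lacks: see the module docstring.
[cite: Liu2021, App. D, proof of Lemma D.1 (first paragraph), p. 126] -/
theorem stub_splitPlace_chiCoinv_iso_parabolicIndGL : splitPlace_chiCoinv_iso_parabolicIndGL := by
  sorry

/-- **stub (L) = B-typ01's named fact IV-3(b) `Zelevinsky1980.parabolicIndGL_detChar_unitary_isIrreducible`** [Zelevinsky1980, Thm. 4.2]: over a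
non-archimedean local field, `parabolicIndGL F (lastBlockLabel N) ((trivial).twist (maxParabolicLeviChar F N ν₀ χ′))` is IRREDUCIBLE for unitary
continuous `ν₀, χ′` (universe pinned to `Type`, where the completions `E_w` live).  Closed by `theorem parabolicIndGL_detChar_unitary_isIrreducible_holds` (KEY candidate `b4-unitary-induction-irreducible`).
[cite: Zelevinsky1980, Thm. 4.2] -/
theorem stub_parabolicIndGL_detChar_unitary_isIrreducible : parabolicIndGL_detChar_unitary_isIrreducible.{0} := by
  sorry

variable (E : Type) [Field E] [NumberField E] (n : ℕ)

/-- **stub (L) = the tree's named fact `Representation.isAdmissible_parabolicIndGL`** at `GL_n(E_w)`, `Q_{n-1,1}` [BernsteinZelevinsky1977, Prop. 2.3]: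
parabolic induction of an admissible representation of the Levi is admissible (`P \ GL_n` compact).  Closed per place `w` (or once for every
non-archimedean local field) by `theorem isAdmissible_parabolicIndGL_holds`; universes pinned to `Type` (the inducing space here is `ℂ`).
[cite: BernsteinZelevinsky1977, Prop. 2.3] -/
theorem stub_isAdmissible_parabolicIndGL (w : HeightOneSpectrum (𝓞 E)) :
    Representation.isAdmissible_parabolicIndGL.{0, 0, 0, 0} (w.adicCompletion E) (lastBlockLabel n) := by
  sorry

/-- **stub (M) — the inducing character is an admissible (one-dimensional) representation of the Levi `GL_{n-1}(E_w) × GL_1(E_w)`**: for unitary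
continuous `ν, χ′ : E_wˣ → ℂˣ`, `(trivial).twist (maxParabolicLeviChar (E_w) n ν (χ′ν^{1-n}))` is admissible — smooth because a continuous
`ℂˣ`-valued character of a totally disconnected locally compact group is trivial on an open subgroup (no small subgroups in `ℂˣ`), and the fixed
vectors of a one-dimensional space are finite-dimensional. [cite: BernsteinZelevinsky1976, §2.1–2.3 (smooth characters)] -/
theorem stub_isAdmissible_leviChar (w : HeightOneSpectrum (𝓞 E)) (ν χ' : (w.adicCompletion E)ˣ →* ℂˣ)
    (hνu : ∀ x, ‖((ν x : ℂˣ) : ℂ)‖ = 1) (hνc : Continuous fun x => ((ν x : ℂˣ) : ℂ))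
    (hχ'u : ∀ x, ‖((χ' x : ℂˣ) : ℂ)‖ = 1) (hχ'c : Continuous fun x => ((χ' x : ℂˣ) : ℂ)) :
    ((Representation.trivial ℂ (Π b : Bool, GL {i : Fin n // lastBlockLabel n i = b} (w.adicCompletion E)) ℂ).twist
      (maxParabolicLeviChar (w.adicCompletion E) n ν (χ' * ν ^ (1 - (n : ℤ))))).IsAdmissible := by
  sorry

end HodgecmMathlib.B4.SplitPlaceModel

/-! ## §C The composition at the §LocalData telescope of `localLemD1Data … v` -/

namespace HodgecmMathlib.B4.SplitPlaceModel

variable (F E : Type) [Field F] [NumberField F] [Field E] [NumberField E] [Algebra F E]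
variable (c : E ≃ₐ[F] E) (N : ℕ) {n : ℕ} (e : Fin N × Fin 1 ≃ Fin n)
variable (JV : Matrix (Fin N) (Fin N) E) {TV : Matrix (Fin N) (Fin N) F}
variable [Algebra.IsQuadraticExtension F E] {δ : E} (hcδ : c δ = -δ) (hδ : δ ≠ 0) {d : F}
  (hd : δ * δ = algebraMap F E d) (hV : TV.IsSymm) (hVd : IsUnit TV.det) (hJV : JV = TV.map (algebraMap F E))
variable (a : Fˣ)
  (𝓢 : LocalSplitting.FinLocalSplittings F E c n hcδ hδ hd (gram F e TV (TW F a)) (isSymm_gram F e hV (isSymm_TW F a))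
    (reindex_kronecker_eq_gram_map F E e hJV (JW_eq F E a)))
  (hn : 3 ≤ n)
  (χ₁ : UnitaryGroup.finAdelicOne F E c →* ℂˣ) (hχ₁n : ∀ u, ‖((χ₁ u : ℂˣ) : ℂ)‖ = 1) (hχ₁c : Continuous χ₁)
  (v : HeightOneSpectrum (𝓞 F))

include hVd hn hχ₁n hχ₁c in
/-- **COMPOSITION (kernel-checked): [Liu2021, Lem. D.1 (1)] at a SPLIT place `v`, `n ≥ 3`** — exactly the statement of
`LemD1Item1AtV.stub_splitPlace_model_consequences` (line `b4-lemD1-item1-at-v` v5, stub (3)) from the four stubs: choose `w ∣ v` (`PlacesOver.nonempty`);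
`¬ IsField (LocalRing E v)` forces `c • w ≠ w` (`LocalRing.isField_of_smul_eq`); `J = (T_V ⊗ 1) ⊗ ⟨a⟩` reindexed is invertible at `w` (`isUnit_placeForm`);
instantiate the MODEL IV-3(a) at the section `s := 𝓢.s v` (`𝓢.omegaLoc v = toRep ∘ 𝓢.s v` by `rfl`), `J₁ := ⟨a⟩`, `χ := χ_{1,v}` and the measure `μ'ⁿ`
(unitarity `hL2`; `μ'ⁿ` is a Haar measure since `F_v` is second countable, `secondCountableTopology_adicCompletion`); the induced representation is irreducible by IV-3(b) at `(ν, χ′ν^{1-n})` (unitary, continuous: `norm_zpow`, `Continuous.zpow₀`) and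
admissible by `isAdmissible_parabolicIndGL` fed with `stub_isAdmissible_leviChar`; transport back along `AreIsomorphicRep` and `localPiSplitEquiv`
(`transport_of_areIsomorphicRep_comp_symm`).  [cite: Liu2021, App. D, proof of Lemma D.1 (first paragraph), p. 126] -/
theorem splitPlace_model_consequences_of
    (hIV3a : splitPlace_chiCoinv_iso_parabolicIndGL) (hIV3b : parabolicIndGL_detChar_unitary_isIrreducible.{0})
    (hIV3c : ∀ w : HeightOneSpectrum (𝓞 E), Representation.isAdmissible_parabolicIndGL.{0, 0, 0, 0} (w.adicCompletion E) (lastBlockLabel n))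
    (hLevi : ∀ (w : HeightOneSpectrum (𝓞 E)) (ν χ' : (w.adicCompletion E)ˣ →* ℂˣ),
      (∀ x, ‖((ν x : ℂˣ) : ℂ)‖ = 1) → (Continuous fun x => ((ν x : ℂˣ) : ℂ)) →
      (∀ x, ‖((χ' x : ℂˣ) : ℂ)‖ = 1) → (Continuous fun x => ((χ' x : ℂˣ) : ℂ)) →
      ((Representation.trivial ℂ (Π b : Bool, GL {i : Fin n // lastBlockLabel n i = b} (w.adicCompletion E)) ℂ).twist
        (maxParabolicLeviChar (w.adicCompletion E) n ν (χ' * ν ^ (1 - (n : ℤ))))).IsAdmissible)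
    [MeasurableSpace (v.adicCompletion F)] [BorelSpace (v.adicCompletion F)] (μ' : Measure (v.adicCompletion F)) [μ'.IsAddHaarMeasure] :
    ¬ IsField (LocalRing E v) → (𝓢.omegaLoc v).IsL2Isometric (Measure.pi fun _ : Fin n => μ') →
      IsIrreducibleOrZero (TwistedCoinv.rep
        (ρW := show Representation ℂ (localPi E c 1 (JW F E a) v) (SchwartzBruhat (Fin n → v.adicCompletion F)) from
          (𝓢.omegaLoc v).comp (localCenter E c n (Matrix.reindex e e (JV ⊗ₖ JW F E a)) (JW F E a) (JW_apply_ne_zero F E a) v))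
        (localCharOfCenter F E c (JW F E a) (JW_apply_ne_zero F E a) χ₁ v) (𝓢.omegaLoc v)
        (fun g z => (show Commute g (localCenter E c n (Matrix.reindex e e (JV ⊗ₖ JW F E a)) (JW F E a) (JW_apply_ne_zero F E a) v z) from
        localCenter_comm E c n (Matrix.reindex e e (JV ⊗ₖ JW F E a)) (JW F E a) (JW_apply_ne_zero F E a) v z g).map (𝓢.omegaLoc v))) ∧
      (TwistedCoinv.rep
        (ρW := show Representation ℂ (localPi E c 1 (JW F E a) v) (SchwartzBruhat (Fin n → v.adicCompletion F)) from
          (𝓢.omegaLoc v).comp (localCenter E c n (Matrix.reindex e e (JV ⊗ₖ JW F E a)) (JW F E a) (JW_apply_ne_zero F E a) v))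
        (localCharOfCenter F E c (JW F E a) (JW_apply_ne_zero F E a) χ₁ v) (𝓢.omegaLoc v)
        (fun g z => (show Commute g (localCenter E c n (Matrix.reindex e e (JV ⊗ₖ JW F E a)) (JW F E a) (JW_apply_ne_zero F E a) v z) from
        localCenter_comm E c n (Matrix.reindex e e (JV ⊗ₖ JW F E a)) (JW F E a) (JW_apply_ne_zero F E a) v z g).map (𝓢.omegaLoc v))).IsAdmissible ∧
      Nontrivial (TwistedCoinv.Coinv
        (show Representation ℂ (localPi E c 1 (JW F E a) v) (SchwartzBruhat (Fin n → v.adicCompletion F)) from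
          (𝓢.omegaLoc v).comp (localCenter E c n (Matrix.reindex e e (JV ⊗ₖ JW F E a)) (JW F E a) (JW_apply_ne_zero F E a) v))
        (localCharOfCenter F E c (JW F E a) (JW_apply_ne_zero F E a) χ₁ v)) := by
  intro hf hL2
  have hc1 : c ≠ 1 := by
    rintro rfl
    rw [AlgEquiv.one_apply] at hcδ
    have h2 : (2 : E) * δ = 0 := by linear_combination hcδ
    exact hδ ((mul_eq_zero.mp h2).resolve_left two_ne_zero)
  haveI := secondCountableTopology_adicCompletion F v
  obtain ⟨w⟩ := (inferInstance : Nonempty (PlacesOver E v))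
  have hw : c • w.1 ≠ w.1 := fun h => hf (LocalRing.isField_of_smul_eq c hc1 w h)
  have hJw : IsUnit (placeForm (Matrix.reindex e e (JV ⊗ₖ JW F E a)) w.1) :=
    isUnit_placeForm (Matrix.reindex e e (JV ⊗ₖ JW F E a))
      ((Matrix.isUnit_iff_isUnit_det _).mpr (isUnit_iff_ne_zero.mpr (det_reindex_kronecker_JW_ne_zero F E N e JV hVd hJV a))) w.1
  obtain ⟨ν, χ', hνu, hνc, hχ'u, hχ'c, hiso⟩ := hIV3a F E c hc1 n (Nat.le_of_succ_le hn) δ hcδ hδ d hd _ _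
    (isUnit_det_gram F e hVd (isUnit_det_TW F a)) _ _ (reindex_kronecker_JW_hermitian F E c N e JV hV hJV a) v w hw hJw
    (Measure.pi fun _ : Fin n => μ') (𝓢.s v) (𝓢.proj_s v) (𝓢.smooth v) hL2 (JW F E a) (JW_apply_ne_zero F E a) _
    (norm_localCharOfCenter F E c (JW F E a) (JW_apply_ne_zero F E a) hχ₁n v)
    (continuous_coe_localCharOfCenter F E c (JW F E a) (JW_apply_ne_zero F E a) hχ₁c v)
  -- the inducing `GL_1`-character `χ′ν^{1-n}` is unitary and continuous
  have hprod : ∀ x, (((χ' * ν ^ (1 - (n : ℤ))) x : ℂˣ) : ℂ) = ((χ' x : ℂˣ) : ℂ) * (((ν x : ℂˣ) : ℂ)) ^ (1 - (n : ℤ)) := fun x => by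
    simp [Units.val_zpow_eq_zpow_val]
  have hu : ∀ x, ‖(((χ' * ν ^ (1 - (n : ℤ))) x : ℂˣ) : ℂ)‖ = 1 := fun x => by
    rw [hprod, norm_mul, norm_zpow, hχ'u, hνu, one_zpow, mul_one]
  have hct : Continuous fun x => (((χ' * ν ^ (1 - (n : ℤ))) x : ℂˣ) : ℂ) := by
    simp_rw [hprod]
    exact hχ'c.mul (hνc.zpow₀ _ fun x => Or.inl (Units.ne_zero _))
  have hirr := hIV3b ((w.1).adicCompletion E) n ν (χ' * ν ^ (1 - (n : ℤ))) hνu hνc hu hct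
  have hadm := hIV3c w.1 _ (hLevi w.1 ν χ' hνu hνc hχ'u hχ'c)
  obtain ⟨h1, h2, h3⟩ := transport_of_areIsomorphicRep_comp_symm _ _ _ hiso hirr hadm
  exact ⟨isIrreducibleOrZero_of_isIrreducible h1, h2, h3⟩

end HodgecmMathlib.B4.SplitPlaceModel

end
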